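import Mathlib
import Literature.Probability.LatticeModels.GKSInequalities
import Summits.CriticalPhenomena.Ising3DConformalLimit.Theorems.PrecisionLaplacianInverseMFerromagnetEntryNonposOfPcov
import Summits.CriticalPhenomena.Ising3DConformalLimit.Theorems.PrecisionLaplacianInverseMFerromagnetLevelTwo
import Summits.CriticalPhenomena.Ising3DConformalLimit.Theorems.PrecisionLaplacianInverseMFerromagnetCondCovNonneg
import HarnessLib

/-!
# Crux `PrecisionLaplacian.InverseMFerromagnet` (stmt-CriticalPhenomena-4798), line `Sketch` —
# stub `helper_af_precision_nonneg_four`: the 4-site antiferromagnet has a precision matrix with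
# nonnegative off-diagonal entries

THEOREM-ONLY file (no definitions).  For the zero-field pair system `gksExpect univ (-K) C` on
`Fin 4` with couplings `-K i ≤ 0` on two-element supports `C i` (the ANTIferromagnet dual to the
ferromagnet `K ≥ 0`), the second-moment matrix `G' p q = ⟨σ_pσ_q⟩'` is positive definite
(`schur_posDef`, no sign needed) and we prove `(G'⁻¹) x y ≥ 0` for `x ≠ y`.

Proof.  Let `S = univ ∖ {x,y} = {u,v}` and `1_s = ∏_{p∈S}(1 + s_pσ_p)/2` the cylinder indicators.
(1) Conditioning on two spins is linear: `s ↦ E'[σ_y 1_s]/E'[1_s]` is odd under the global flip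
(`|C i| = 2`), hence of the form `∑_{q∈S} λ_q s_q` (`l2_odd_linear`), so the residual numbers
`R_p := ⟨σ_pσ_y⟩' − ∑_s E'[σ_p1_s]E'[σ_y1_s]/E'[1_s]` satisfy `R_p = G'_py − ∑_q λ_q G'_pq` and
`R_q = 0` for `q ∈ S` (`afp_residual`).  (2) On each cylinder only the four values of
`(σ_x, σ_y)` vary, and the Boltzmann weights `W_{ab}` there satisfy `W₊₊W₋₋ ≤ W₊₋W₋₊` because the
only coupling seen by the pair is `∑_{C i = {x,y}} (-K i) ≤ 0`; hence the conditional covariance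
of `(σ_x, σ_y)` is `≤ 0` (`afp_cyl_af`) and, summing over cylinders, `R_x ≤ 0` (`afp_sum_le`).
(3) Linear algebra (`afp_inv_entry_nonneg`, the computation of `schur_inv_entry_nonpos` with the
residual in place of the Schur complement): reading `Γ G' = 1` (`Γ = G'⁻¹`) against `R` gives
`Γ_xx R_x + Γ_xy R_y = 0`, `Γ_xy R_x + Γ_yy R_y = 1`, whence `Γ_xy = −(Γ_xxΓ_yy − Γ_xy²) R_x ≥ 0`.
-/

namespace Summit.CriticalPhenomena.Ising3DConformalLimit.Cruxes.InverseMFerromagnet.PartialCovarianceLadder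

open Literature.Probability.LatticeModels Finset Matrix

/-! ## Linear algebra: the sign of an inverse entry from a residual -/

/-- For a positive definite `G` on `Fin n`, `x ≠ y`, `S = univ ∖ {x,y}`: if numbers `R_p` satisfy
`R_p = G_py − ∑_{q∈S} λ_q G_pq` for all `p`, `R_q = 0` on `S` and `R_x ≤ 0`, then `(G⁻¹)_xy ≥ 0`
(from `Γ G = 1`: `Γ_xx R_x + Γ_xy R_y = 0`, `Γ_xy R_x + Γ_yy R_y = 1`, so
`Γ_xy = −(Γ_xxΓ_yy − Γ_xy²) R_x`). [folklore] -/
theorem afp_inv_entry_nonneg {n : ℕ} (G : Matrix (Fin n) (Fin n) ℝ) (hG : G.PosDef)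
    (x y : Fin n) (S : Finset (Fin n)) (hxy : x ≠ y) (hS : S = (Finset.univ.erase x).erase y)
    (lam : ↥S → ℝ) (R : Fin n → ℝ) (hR : ∀ p, R p = G p y - ∑ q : ↥S, lam q * G p q.1)
    (hRS : ∀ q : ↥S, R q.1 = 0) (hRx : R x ≤ 0) : 0 ≤ G⁻¹ x y := by
  obtain ⟨hxS, hyS⟩ : x ∉ S ∧ y ∉ S := ⟨by simp [hS], by simp [hS]⟩
  set Γ : Matrix (Fin n) (Fin n) ℝ := G⁻¹
  have hΓpd : Γ.PosDef := hG.inv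
  have hΓG : Γ * G = 1 :=
    Matrix.nonsing_inv_mul G ((Matrix.isUnit_iff_isUnit_det G).mp hG.isUnit)
  have hE : ∀ i j, ∑ p, Γ i p * G p j = (1 : Matrix (Fin n) (Fin n) ℝ) i j := fun i j => by
    have h := congrFun (congrFun hΓG i) j
    rwa [Matrix.mul_apply] at h
  -- two evaluations of `∑_p Γ_ip R_p`
  have h1 : ∀ i, ∑ p, Γ i p * R p = (1 : Matrix (Fin n) (Fin n) ℝ) i y
      - ∑ q : ↥S, lam q * (1 : Matrix (Fin n) (Fin n) ℝ) i q.1 := by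
    intro i
    simp_rw [hR, mul_sub, Finset.sum_sub_distrib, hE i y]
    congr 1
    simp_rw [Finset.mul_sum]
    rw [Finset.sum_comm]
    refine Finset.sum_congr rfl fun q _ => ?_
    rw [← hE i q.1, Finset.mul_sum]
    exact Finset.sum_congr rfl fun p _ => by ring
  have h2 : ∀ i, ∑ p, Γ i p * R p = Γ i x * R x + Γ i y * R y := by
    intro i
    rw [schur_sum_split hxy hS]
    simp [hRS]
  have ex : Γ x x * R x + Γ x y * R y = 0 := by
    rw [← h2, h1, Matrix.one_apply_ne hxy, zero_sub, neg_eq_zero]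
    exact Finset.sum_eq_zero fun q _ => by
      rw [Matrix.one_apply_ne (fun h => hxS (by rw [h]; exact q.2)), mul_zero]
  have ey : Γ y x * R x + Γ y y * R y = 1 := by
    rw [← h2, h1, Matrix.one_apply_eq, sub_eq_self]
    exact Finset.sum_eq_zero fun q _ => by
      rw [Matrix.one_apply_ne (fun h => hyS (by rw [h]; exact q.2)), mul_zero]
  have hsym : Γ y x = Γ x y := by
    have h := hΓpd.isHermitian.apply x y
    simpa using h
  have hdet : 0 < Γ x x * Γ y y - Γ x y * Γ x y := by
    have h := schur_det_two_pos hΓpd hxy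
    rwa [hsym] at h
  rw [hsym] at ey
  have hfin : Γ x y = -((Γ x x * Γ y y - Γ x y * Γ x y) * R x) := by
    linear_combination Γ y y * ex - Γ x y * ey
  rw [hfin]
  exact neg_nonneg.mpr (mul_nonpos_of_nonneg_of_nonpos hdet.le hRx)

/-! ## Conditioning on two spins: the residual of `σ_y` after its conditional expectation -/

/-- For a zero-field pair system (`|C i| = 2`, couplings of any sign) and `|S| = 2`, the conditional
expectation `s ↦ E[σ_y 1_s]/E[1_s]` is odd, hence linear `= ∑_{q∈S} λ_q s_q` (`l2_odd_linear`);
consequently `∑_s E[σ_z1_s]E[σ_y1_s]/E[1_s] = ∑_q λ_q ⟨σ_zσ_q⟩` for every site `z`, and this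
equals `⟨σ_qσ_y⟩` itself when `z = q ∈ S`. [folklore] -/
theorem afp_residual {n m : ℕ} (K : Fin m → ℝ) (C : Fin m → Finset (Fin n))
    (hC : ∀ i, (C i).card = 2) (y : Fin n) (S : Finset (Fin n)) (hS2 : S.card = 2) :
    ∃ lam : ↥S → ℝ,
      (∀ z : Fin n, ∑ s : ↥S → ℤˣ,
          gksExpect Finset.univ K C (fun ω => spinAt z ω *
              ∏ p : ↥S, (1 + (((s p : ℤˣ) : ℤ) : ℝ) * spinAt p.1 ω) / 2) *
            gksExpect Finset.univ K C (fun ω => spinAt y ω *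
              ∏ p : ↥S, (1 + (((s p : ℤˣ) : ℤ) : ℝ) * spinAt p.1 ω) / 2) /
            gksExpect Finset.univ K C (fun ω =>
              ∏ p : ↥S, (1 + (((s p : ℤˣ) : ℤ) : ℝ) * spinAt p.1 ω) / 2)
        = ∑ q : ↥S, lam q * gksExpect Finset.univ K C (fun ω => spinAt z ω * spinAt q.1 ω)) ∧
      (∀ q : ↥S, gksExpect Finset.univ K C (fun ω => spinAt q.1 ω * spinAt y ω)
        = ∑ s : ↥S → ℤˣ,
          gksExpect Finset.univ K C (fun ω => spinAt q.1 ω *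
              ∏ p : ↥S, (1 + (((s p : ℤˣ) : ℤ) : ℝ) * spinAt p.1 ω) / 2) *
            gksExpect Finset.univ K C (fun ω => spinAt y ω *
              ∏ p : ↥S, (1 + (((s p : ℤˣ) : ℤ) : ℝ) * spinAt p.1 ω) / 2) /
            gksExpect Finset.univ K C (fun ω =>
              ∏ p : ↥S, (1 + (((s p : ℤˣ) : ℤ) : ℝ) * spinAt p.1 ω) / 2)) := by
  -- cylinder indicators, folded into an opaque function `ind`
  obtain ⟨ind, hind⟩ : ∃ ind : (↥S → ℤˣ) → SpinConfig (Fin n) → ℝ,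
      ∀ s ω, ind s ω = ∏ p : ↥S, (1 + (((s p : ℤˣ) : ℤ) : ℝ) * spinAt p.1 ω) / 2 :=
    ⟨_, fun _ _ => rfl⟩
  have hindneg : ∀ s ω, ind (-s) ω = ind s (-ω) := fun s ω => by
    rw [hind, hind]
    exact l2_ind_neg S s ω
  -- `P s = E[1_s]`, `a z s = E[σ_z 1_s]`, as opaque functions
  obtain ⟨P, hPdef⟩ : ∃ P : (↥S → ℤˣ) → ℝ,
      ∀ s, P s = gksExpect Finset.univ K C (fun ω => ind s ω) := ⟨_, fun _ => rfl⟩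
  obtain ⟨a, hadef⟩ : ∃ a : Fin n → (↥S → ℤˣ) → ℝ,
      ∀ z s, a z s = gksExpect Finset.univ K C (fun ω => spinAt z ω * ind s ω) :=
    ⟨_, fun _ _ => rfl⟩
  simp only [← hind, ← hPdef, ← hadef]
  -- positivity and flip symmetry
  have hPpos : ∀ s, 0 < P s := fun s => by
    rw [hPdef]
    simp only [hind]
    exact l2_P_pos K C S s
  have hPneg : ∀ s, P (-s) = P s := fun s => by
    rw [hPdef, hPdef]
    simp_rw [hindneg]
    exact l2_gksExpect_comp_neg K C hC _
  have haneg : ∀ z s, a z (-s) = -a z s := fun z s => by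
    rw [hadef, hadef]
    simp_rw [hindneg]
    have h1 : (fun ω => spinAt z ω * ind s (-ω))
        = fun ω => (fun ω' => -(spinAt z ω' * ind s ω')) (-ω) := by
      funext ω
      simp [l2_spinAt_neg]
    rw [h1, l2_gksExpect_comp_neg K C hC (fun ω' => -(spinAt z ω' * ind s ω')), l2_gksExpect_neg]
  -- second moments against the cylinder functions: `⟨σ_zσ_p⟩ = ∑_s a z s · s_p` for `p ∈ S`
  have hcol : ∀ (z : Fin n) (p : ↥S), gksExpect Finset.univ K C (fun ω => spinAt z ω * spinAt p.1 ω)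
      = ∑ s, a z s * (((s p : ℤˣ) : ℤ) : ℝ) := by
    intro z p
    calc gksExpect Finset.univ K C (fun ω => spinAt z ω * spinAt p.1 ω)
        = gksExpect Finset.univ K C
            (fun ω => ∑ s : ↥S → ℤˣ, (((s p : ℤˣ) : ℤ) : ℝ) * (spinAt z ω * ind s ω)) := by
          congr 1
          funext ω
          have h := l2_sum_ind_mul S ω (fun s => (((s p : ℤˣ) : ℤ) : ℝ))
          simp only [← hind] at h
          rw [show (∑ s : ↥S → ℤˣ, (((s p : ℤˣ) : ℤ) : ℝ) * (spinAt z ω * ind s ω))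
              = spinAt z ω * ∑ s : ↥S → ℤˣ, ind s ω * (((s p : ℤˣ) : ℤ) : ℝ) by
            rw [Finset.mul_sum]
            exact Finset.sum_congr rfl fun s _ => by ring, h]
          rfl
      _ = ∑ s, (((s p : ℤˣ) : ℤ) : ℝ) * a z s := by
          rw [l2_gksExpect_sum_mul]
          simp only [hadef]
      _ = ∑ s, a z s * (((s p : ℤˣ) : ℤ) : ℝ) := Finset.sum_congr rfl fun s _ => mul_comm _ _
  -- `a q s = s_q · P s` for `q ∈ S`
  have haS : ∀ (q : ↥S) (s : ↥S → ℤˣ), a q.1 s = (((s q : ℤˣ) : ℤ) : ℝ) * P s := by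
    intro q s
    rw [hadef, hPdef, ← schur_gksExpect_const_mul]
    congr 1
    funext ω
    rw [hind, l2_ind_eq_ite]
    by_cases h : s = fun p : ↥S => ω p.1
    · rw [if_pos h, h]
      rfl
    · rw [if_neg h, mul_zero, mul_zero]
  -- the conditional expectation of `σ_y` is odd, hence linear
  have hcard : Fintype.card ↥S = 2 := by simp [hS2]
  obtain ⟨lam, hlam⟩ := l2_odd_linear hcard (fun s => a y s / P s) (fun s => by
    simp only [haneg, hPneg, neg_div])
  refine ⟨lam, fun z => ?_, fun q => ?_⟩
  · calc ∑ s, a z s * a y s / P s = ∑ s, a z s * ∑ q, lam q * (((s q : ℤˣ) : ℤ) : ℝ) := by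
          refine Finset.sum_congr rfl fun s _ => ?_
          rw [mul_div_assoc, hlam s]
      _ = ∑ q, lam q * ∑ s, a z s * (((s q : ℤˣ) : ℤ) : ℝ) := by
          simp_rw [Finset.mul_sum]
          rw [Finset.sum_comm]
          exact Finset.sum_congr rfl fun q _ => Finset.sum_congr rfl fun s _ => by ring
      _ = ∑ q, lam q * gksExpect Finset.univ K C (fun ω => spinAt z ω * spinAt q.1 ω) := by
          simp_rw [hcol]
  · calc gksExpect Finset.univ K C (fun ω => spinAt q.1 ω * spinAt y ω)
        = gksExpect Finset.univ K C (fun ω => spinAt y ω * spinAt q.1 ω) := by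
          simp_rw [mul_comm]
      _ = ∑ s, a y s * (((s q : ℤˣ) : ℤ) : ℝ) := hcol y q
      _ = ∑ s, a q.1 s * a y s / P s := by
          refine Finset.sum_congr rfl fun s _ => ?_
          rw [haS q s]
          field_simp [(hPpos s).ne']

/-! ## The antiferromagnetic pair inequality on a cylinder over `S = univ ∖ {x,y}` -/

/-- A cylinder over `S = univ ∖ {x,y}` consists of the four configurations `e a b`
(`a, b = ±1` the spins at `x, y`): `∑_ω g(ω) 1_s(ω) = ∑_{a,b} g(e a b)`. [folklore] -/
theorem afp_cyl_sum {n : ℕ} {x y : Fin n} {S : Finset (Fin n)} (hxy : x ≠ y)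
    (hS : S = (Finset.univ.erase x).erase y) (s : ↥S → ℤˣ) (e : ℤˣ → ℤˣ → SpinConfig (Fin n))
    (he : ∀ a b p, e a b p = if hp : p ∈ S then s ⟨p, hp⟩ else if p = x then a else b)
    (g : SpinConfig (Fin n) → ℝ) :
    ∑ ω, g ω * (∏ p : ↥S, (1 + (((s p : ℤˣ) : ℤ) : ℝ) * spinAt p.1 ω) / 2)
      = g (e 1 1) + g (e 1 (-1)) + (g (e (-1) 1) + g (e (-1) (-1))) := by
  obtain ⟨hxS, hyS⟩ : x ∉ S ∧ y ∉ S := ⟨by simp [hS], by simp [hS]⟩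
  have hmem : ∀ r, r ∉ S → r = x ∨ r = y := by
    intro r hr
    rcases eq_or_ne r x with h | hx
    · exact Or.inl h
    rcases eq_or_ne r y with h | hy
    · exact Or.inr h
    exact absurd (by rw [hS]; exact mem_erase.2 ⟨hy, mem_erase.2 ⟨hx, mem_univ r⟩⟩) hr
  have hiff : ∀ ω a b, ω = e a b ↔ (∀ p : ↥S, ω p.1 = s p) ∧ ω x = a ∧ ω y = b := by
    intro ω a b
    constructor
    · rintro rfl
      refine ⟨fun p => ?_, ?_, ?_⟩
      · rw [he, dif_pos p.2]
      · rw [he, dif_neg hxS, if_pos rfl]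
      · rw [he, dif_neg hyS, if_neg hxy.symm]
    · rintro ⟨hSω, hx, hy⟩
      funext p
      rw [he]
      by_cases hp : p ∈ S
      · rw [dif_pos hp]
        exact hSω ⟨p, hp⟩
      · rw [dif_neg hp]
        rcases hmem p hp with rfl | rfl
        · rw [if_pos rfl]; exact hx
        · rw [if_neg hxy.symm]; exact hy
  -- the indicator of the cylinder is the sum of the indicators of its four points
  have hkey : ∀ ω, g ω * (∏ p : ↥S, (1 + (((s p : ℤˣ) : ℤ) : ℝ) * spinAt p.1 ω) / 2)
      = ∑ a : ℤˣ, ∑ b : ℤˣ, if ω = e a b then g ω else 0 := by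
    intro ω
    rw [cyl_eq_ite]
    by_cases hSω : ∀ p : ↥S, ω p.1 = s p
    · have hiff' : ∀ a b, ω = e a b ↔ ω x = a ∧ ω y = b := fun a b => by
        rw [hiff]
        exact ⟨fun h => h.2, fun h => ⟨hSω, h⟩⟩
      simp_rw [hiff', if_pos hSω, mul_one]
      rw [Finset.sum_eq_single (ω x)]
      · rw [Finset.sum_eq_single (ω y)]
        · rw [if_pos ⟨rfl, rfl⟩]
        · intro b _ hb
          rw [if_neg (fun h => hb h.2.symm)]
        · intro h
          exact absurd (Finset.mem_univ _) h
      · intro a _ ha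
        exact Finset.sum_eq_zero fun b _ => by rw [if_neg (fun h => ha h.1.symm)]
      · intro h
        exact absurd (Finset.mem_univ _) h
    · have hiff' : ∀ a b, ¬ ω = e a b := fun a b h => hSω ((hiff ω a b).1 h).1
      simp only [hiff', if_false, if_neg hSω, mul_zero, Finset.sum_const_zero]
  simp_rw [hkey]
  rw [Finset.sum_comm]
  simp_rw [Finset.sum_comm (s := (Finset.univ : Finset (SpinConfig (Fin n)))),
    Finset.sum_ite_eq', Finset.mem_univ, if_true]
  rw [UnitsInt.univ, Finset.sum_pair (by decide), Finset.sum_pair (by decide),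
    Finset.sum_pair (by decide)]

/-- **The pair `(σ_x, σ_y)` is negatively correlated on every cylinder over `S = univ ∖ {x,y}`**
when all couplings are `≤ 0` (`|C i| = 2`): `Z⟨σ_xσ_y1_s⟩ Z⟨1_s⟩ ≤ Z⟨σ_x1_s⟩ Z⟨σ_y1_s⟩`.  On the
cylinder the weights `W_{ab}` of the four configurations satisfy `W₊₊W₋₋ ≤ W₊₋W₋₊` (bonds inside
`S` are frozen, bonds from `S` to `x` or `y` act as fields and cancel, the bonds `{x,y}` carry a
coupling `≤ 0`), and `(XY)(1) − (X)(Y) = 4(W₊₊W₋₋ − W₊₋W₋₊)`. [folklore] -/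
theorem afp_cyl_af {n m : ℕ} (K : Fin m → ℝ) (C : Fin m → Finset (Fin n)) (hK : ∀ i, K i ≤ 0)
    (hC : ∀ i, (C i).card = 2) {x y : Fin n} {S : Finset (Fin n)} (hxy : x ≠ y)
    (hS : S = (Finset.univ.erase x).erase y) (s : ↥S → ℤˣ) :
    gksSum Finset.univ K C (fun ω => spinAt x ω * spinAt y ω *
          ∏ p : ↥S, (1 + (((s p : ℤˣ) : ℤ) : ℝ) * spinAt p.1 ω) / 2) *
        gksSum Finset.univ K C (fun ω =>
          ∏ p : ↥S, (1 + (((s p : ℤˣ) : ℤ) : ℝ) * spinAt p.1 ω) / 2) ≤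
      gksSum Finset.univ K C (fun ω => spinAt x ω *
          ∏ p : ↥S, (1 + (((s p : ℤˣ) : ℤ) : ℝ) * spinAt p.1 ω) / 2) *
        gksSum Finset.univ K C (fun ω => spinAt y ω *
          ∏ p : ↥S, (1 + (((s p : ℤˣ) : ℤ) : ℝ) * spinAt p.1 ω) / 2) := by
  obtain ⟨hxS, hyS⟩ : x ∉ S ∧ y ∉ S := ⟨by simp [hS], by simp [hS]⟩
  obtain ⟨e, he⟩ : ∃ e : ℤˣ → ℤˣ → SpinConfig (Fin n),
      ∀ a b p, e a b p = if hp : p ∈ S then s ⟨p, hp⟩ else if p = x then a else b :=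
    ⟨fun a b p => if hp : p ∈ S then s ⟨p, hp⟩ else if p = x then a else b, fun _ _ _ => rfl⟩
  have hex : ∀ a b, spinAt x (e a b) = ((a : ℤ) : ℝ) := fun a b => by
    simp [spinAt, he, hxS]
  have hey : ∀ a b, spinAt y (e a b) = ((b : ℤ) : ℝ) := fun a b => by
    simp [spinAt, he, hyS, hxy.symm]
  -- every spin is an affine function `α a + β b + γ` of `(a, b)` on the cylinder, `α, β ≥ 0`
  have hlin : ∀ r : Fin n, ∃ α β γ : ℝ, 0 ≤ α ∧ 0 ≤ β ∧
      ∀ a b : ℤˣ, spinAt r (e a b) = α * ((a : ℤ) : ℝ) + β * ((b : ℤ) : ℝ) + γ := by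
    intro r
    by_cases hr : r ∈ S
    · exact ⟨0, 0, (((s ⟨r, hr⟩ : ℤˣ) : ℤ) : ℝ), le_rfl, le_rfl, fun a b => by
        simp [spinAt, he, hr]⟩
    · rcases eq_or_ne r x with rfl | hrx
      · exact ⟨1, 0, 0, zero_le_one, le_rfl, fun a b => by rw [hex]; ring⟩
      · rcases eq_or_ne r y with rfl | hry
        · exact ⟨0, 1, 0, le_rfl, zero_le_one, fun a b => by rw [hey]; ring⟩
        · exact absurd (by rw [hS]; exact Finset.mem_erase.2 ⟨hry, Finset.mem_erase.2
            ⟨hrx, Finset.mem_univ r⟩⟩) hr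
  -- the antiferromagnetic lattice inequality `W₊₊ W₋₋ ≤ W₊₋ W₋₊`
  have hw : gksWeight Finset.univ K C (e 1 1) * gksWeight Finset.univ K C (e (-1) (-1)) ≤
      gksWeight Finset.univ K C (e 1 (-1)) * gksWeight Finset.univ K C (e (-1) 1) := by
    simp only [gksWeight, ← Real.exp_add]
    refine Real.exp_le_exp.2 ?_
    simp only [gksHamiltonian, ← Finset.sum_add_distrib]
    refine Finset.sum_le_sum fun i _ => ?_
    obtain ⟨p, q, hpq, hi⟩ := Finset.card_eq_two.1 (hC i)
    obtain ⟨α, β, γ, hα, hβ, hp⟩ := hlin p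
    obtain ⟨α', β', γ', hα', hβ', hq⟩ := hlin q
    simp only [hi, spinProduct, Finset.prod_pair hpq, hp, hq, Units.val_one, Units.val_neg,
      Int.cast_one, Int.cast_neg]
    nlinarith [mul_nonneg (mul_nonneg hα hβ') (neg_nonneg.2 (hK i)),
      mul_nonneg (mul_nonneg hβ hα') (neg_nonneg.2 (hK i))]
  -- reduce the four `Z⟨· 1_s⟩` to sums over the four points of the cylinder
  have h4 := afp_cyl_sum hxy hS s e he
  simp only [gksSum]
  have hr : ∀ F : SpinConfig (Fin n) → ℝ,
      ∑ ω, F ω * (∏ p : ↥S, (1 + (((s p : ℤˣ) : ℤ) : ℝ) * spinAt p.1 ω) / 2) *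
          gksWeight Finset.univ K C ω
        = ∑ ω, (F ω * gksWeight Finset.univ K C ω) *
          (∏ p : ↥S, (1 + (((s p : ℤˣ) : ℤ) : ℝ) * spinAt p.1 ω) / 2) :=
    fun F => Finset.sum_congr rfl fun ω _ => by ring
  have hr1 : ∑ ω, (∏ p : ↥S, (1 + (((s p : ℤˣ) : ℤ) : ℝ) * spinAt p.1 ω) / 2) *
        gksWeight Finset.univ K C ω
      = ∑ ω, gksWeight Finset.univ K C ω *
        (∏ p : ↥S, (1 + (((s p : ℤˣ) : ℤ) : ℝ) * spinAt p.1 ω) / 2) :=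
    Finset.sum_congr rfl fun ω _ => mul_comm _ _
  rw [hr, hr, hr, hr1, h4, h4, h4, h4]
  simp only [hex, hey, Units.val_one, Units.val_neg, Int.cast_one, Int.cast_neg]
  nlinarith [hw]

/-- **Summing the cylinder inequalities**: for a partition of unity `χ_s` with positive masses and
`Z⟨σ_xσ_yχ_s⟩ Z⟨χ_s⟩ ≤ Z⟨σ_xχ_s⟩ Z⟨σ_yχ_s⟩` for every `s`,
`⟨σ_xσ_y⟩ ≤ ∑_s ⟨σ_xχ_s⟩⟨σ_yχ_s⟩/⟨χ_s⟩`. [folklore] -/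
theorem afp_sum_le {n m : ℕ} (K : Fin m → ℝ) (C : Fin m → Finset (Fin n)) (x y : Fin n)
    {ι : Type*} [Fintype ι] (χ : ι → SpinConfig (Fin n) → ℝ)
    (hχpos : ∀ s, 0 < gksSum Finset.univ K C (χ s)) (hχsum : ∀ ω, ∑ s, χ s ω = 1)
    (hχ : ∀ s, gksSum Finset.univ K C (fun ω => spinAt x ω * spinAt y ω * χ s ω) *
        gksSum Finset.univ K C (χ s) ≤
      gksSum Finset.univ K C (fun ω => spinAt x ω * χ s ω) *
        gksSum Finset.univ K C (fun ω => spinAt y ω * χ s ω)) :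
    gksExpect Finset.univ K C (fun ω => spinAt x ω * spinAt y ω) ≤
      ∑ s, gksExpect Finset.univ K C (fun ω => spinAt x ω * χ s ω) *
        gksExpect Finset.univ K C (fun ω => spinAt y ω * χ s ω) /
          gksExpect Finset.univ K C (χ s) := by
  have hZ := gksSum_one_pos Finset.univ K C
  simp only [gksExpect]
  set Z : ℝ := gksSum Finset.univ K C (fun _ => 1)
  have halg : ∀ a b p : ℝ, a / Z * (b / Z) / (p / Z) = a * b / p / Z := by
    intro a b p
    rcases eq_or_ne p 0 with rfl | hp
    · simp
    · field_simp
  simp only [halg]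
  rw [← Finset.sum_div]
  refine div_le_div_of_nonneg_right ?_ hZ.le
  rw [gksSum_eq_sum_gksSum_mul K C χ hχsum (fun ω => spinAt x ω * spinAt y ω)]
  refine Finset.sum_le_sum fun s _ => ?_
  rw [le_div_iff₀ (hχpos s)]
  exact hχ s

/-! ## The registered stub -/

/-- Registered stub `helper_af_precision_nonneg_four`: for the 4-site pair antiferromagnet
`gksExpect univ (-K) C` (`K ≥ 0`, `|C i| = 2`) the precision matrix `(⟨σ_pσ_q⟩')⁻¹` has
nonnegative off-diagonal entries.  With `S = univ ∖ {x,y}` (two sites): the conditional expectation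
given `σ_S` is linear (`afp_residual`), the conditional covariance of `(σ_x,σ_y)` is `≤ 0`
(`afp_cyl_af`, `afp_sum_le`), and the residual form of the Schur step (`afp_inv_entry_nonneg`)
turns `R_x ≤ 0` into `(G'⁻¹)_xy ≥ 0`. [folklore] -/
theorem helper_af_precision_nonneg_four : ∀ (m : ℕ) (K : Fin m → ℝ) (C : Fin m → Finset (Fin 4)), (∀ i, 0 ≤ K i) → (∀ i, (C i).card = 2) → ∀ x y : Fin 4, x ≠ y → 0 ≤ (Matrix.of fun p q : Fin 4 => gksExpect Finset.univ (fun i => -K i) C (fun ω => spinAt p ω * spinAt q ω))⁻¹ x y := by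
  intro m K C hK hC x y hxy
  have hK' : ∀ i, (fun i => -K i) i ≤ 0 := fun i => neg_nonpos.2 (hK i)
  obtain ⟨S, hS⟩ : ∃ S : Finset (Fin 4), S = (Finset.univ.erase x).erase y := ⟨_, rfl⟩
  have hS2 : S.card = 2 := by
    rw [hS, Finset.card_erase_of_mem (Finset.mem_erase.2 ⟨hxy.symm, Finset.mem_univ y⟩),
      Finset.card_erase_of_mem (Finset.mem_univ x), Finset.card_univ, Fintype.card_fin]
  obtain ⟨lam, h1, h2⟩ := afp_residual (fun i => -K i) C hC y S hS2
  have h3 := afp_sum_le (fun i => -K i) C x y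
    (fun (s : ↥S → ℤˣ) (ω : SpinConfig (Fin 4)) =>
      ∏ p : ↥S, (1 + (((s p : ℤˣ) : ℤ) : ℝ) * spinAt p.1 ω) / 2)
    (gksSum_cyl_pos _ C S) (sum_cyl_eq_one S) (fun s => afp_cyl_af _ C hK' hC hxy hS s)
  refine afp_inv_entry_nonneg _ (schur_posDef 4 m (fun i => -K i) C) x y S hxy hS lam
    (fun p => gksExpect Finset.univ (fun i => -K i) C (fun ω => spinAt p ω * spinAt y ω) -
      ∑ s : ↥S → ℤˣ,
        gksExpect Finset.univ (fun i => -K i) C (fun ω => spinAt p ω *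
            ∏ p : ↥S, (1 + (((s p : ℤˣ) : ℤ) : ℝ) * spinAt p.1 ω) / 2) *
          gksExpect Finset.univ (fun i => -K i) C (fun ω => spinAt y ω *
            ∏ p : ↥S, (1 + (((s p : ℤˣ) : ℤ) : ℝ) * spinAt p.1 ω) / 2) /
          gksExpect Finset.univ (fun i => -K i) C (fun ω =>
            ∏ p : ↥S, (1 + (((s p : ℤˣ) : ℤ) : ℝ) * spinAt p.1 ω) / 2))
    (fun p => ?_) (fun q => ?_) ?_
  · exact congrArg (fun t : ℝ =>
      gksExpect Finset.univ (fun i => -K i) C (fun ω => spinAt p ω * spinAt y ω) - t) (h1 p)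
  · simp only [h2 q, sub_self]
  · linarith [h3]

end Summit.CriticalPhenomena.Ising3DConformalLimit.Cruxes.InverseMFerromagnet.PartialCovarianceLadder
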